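import Summits.Schanuel.Schanuel.Theorems.RootDecomp1BFiniteOrderRadical04

/-!
# RootDecomp1BFiniteOrderRadical — lens 4, generation 34 «FINITE-ORDER NESTERENKO STOREY» (X(2) at (π, ρπ) for every ρ of exponential Liouville order 57) — continuation (RootDecomp1BFiniteOrderRadical05): §C the named members `rhoT = towerNumber 58` (order 57, NOT hyper) and `lambdaH` (hyper) with the LIVE X applied as a hypothesis, separation from every earlier cell (hypothesis-free), the flagship ∃-cell `exists_storey_two_cell_pi_finiteOrder (hN)` and the `_of_facts` re-keyings

(lens-4 g34 `FiniteOrderRadical.lean`, sha256 721281aa…4b53, own farm rc 0 · 0 sorry · axioms std; critic VERDICT STATUS L1761 (credit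
B-R21 (d), PORT GO LOW); port by census-1 gen 16 in parts `RootDecomp1BFiniteOrderRadical01`–`05` (+ `06` hypothesis-free when the farm builds the
`_holds` cone) — see the PORT NOTE of part 01; `--supports stmt-Schanuel-24622`; rung 0.)
-/

noncomputable section

open Complex

namespace Summit.Schanuel.Schanuel.Theorems.RootDecomp1BFiniteOrderRadical

section Cells

open IntermediateField
open Literature.Barriers.Schanuel (ramanujanP ramanujanQ ramanujanR ramanujan_values_exp_neg_two_pi_holds
  nesterenko1996_thm_1_1 NesterenkoPhilippon2001_ch3_thm_5_1)
open Literature.NumberTheory.Transcendental.Nesterenko (NesterenkoPhilippon2001_ch3_prop_4_11)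
open Summit.Schanuel.Schanuel.Theorems.RootDecomp1BFedFlagCore (polarDeg polarField coe_mem_polarField
  exp_coe_mem_polarField)
open Summit.Schanuel.Schanuel.Theorems.RootDecomp1BTameFlagCore (IsWild IsTame LastTame HasSharpHyperplane)
open Summit.Schanuel.Schanuel.Theorems.RootDecomp1BDefectFloorDefs (SharpRelativeLindemannAt TameDefectZeroAt
  WildSharpDefectZeroAt WildSharpDefectZeroInitAt)
open Summit.Schanuel.Schanuel.Theorems.RootDecomp1BDefectFloorCells (natCast_le_trdeg_of_algebraicIndependent)
open Summit.Schanuel.Schanuel.Theorems.RootDecomp1BNesterenkoRadical (linearIndependent_pi_smul_pi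
  linearIndependent_smul_pi_pi lastTame_smul_pi_pi isTame_pi_smul_pi not_isWild_pi_smul_pi
  hasSharpHyperplane_pi_smul_pi polarDeg_init_pi_smul_pi_le not_liouville_pi)
open Summit.Schanuel.Schanuel.Theorems.RootDecomp1BRadicalDescent (UltraLiouville)
open Summit.Schanuel.Schanuel.Theorems.RootDecomp1KHyper.HyperCell (HyperLiouville lambdaH hyperLiouville_lambdaH)
open Summit.Schanuel.Schanuel.Theorems.RootDecomp1KGeneric (LiouvilleOrder)
open Summit.Schanuel.Schanuel.Theorems.RootDecomp1KFiniteOrderCell (towerNumber liouvilleOrder_towerNumber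
  liouville_towerNumber not_hyperLiouville_towerNumber not_liouvilleOrder_towerNumber towerNumber_pos)

/-! ### The NAMED MEMBER outside every earlier cell: `ρ_T = towerNumber 58` (order 57, NOT hyper-Liouville) -/

/-- `ρ_T := T_58 = Σ_k 2^{−t_k}`, `t_{k+1} = t_k^{58}` (tree `RootDecomp1KFiniteOrderCell.towerNumber`). -/
def rhoT : ℝ := towerNumber 58

/-- `ρ_T` has exponential Liouville order `57` … -/
theorem liouvilleOrder_rhoT : LiouvilleOrder 57 rhoT := liouvilleOrder_towerNumber 57

/-- … is NOT hyper-Liouville (tree `not_hyperLiouville_towerNumber`) … -/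
theorem not_hyperLiouville_rhoT : ¬ HyperLiouville rhoT := not_hyperLiouville_towerNumber (by norm_num)

/-- … hence not ultra-Liouville … -/
theorem not_ultraLiouville_rhoT : ¬ UltraLiouville rhoT := fun h => not_hyperLiouville_rhoT h.hyperLiouville

/-- … does not have order `59` (tree `not_liouvilleOrder_towerNumber`; order `58` is left open) … -/
theorem not_liouvilleOrder_rhoT : ¬ LiouvilleOrder 59 rhoT := not_liouvilleOrder_towerNumber (c := 58) (by norm_num)

/-- … is a Liouville number, positive and irrational. -/
theorem rhoT_liouville_pos_irrational : Liouville rhoT ∧ 0 < rhoT ∧ Irrational rhoT :=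
  ⟨liouville_towerNumber (by norm_num), towerNumber_pos (by norm_num), liouvilleOrder_rhoT.irrational (by norm_num)⟩

/-- **THE NAMED CELL: `t(π, ρ_T π) ≥ 4`**, hypothesis-free. -/
theorem four_le_polarDeg_pi_rhoT (hN : LogSizeMeasure 4 24 nesterenkoTriple) : ((2 + 2 : ℕ) : Cardinal) ≤ polarDeg ![Real.pi, rhoT * Real.pi] :=
  four_le_polarDeg_pi hN liouvilleOrder_rhoT

/-- `(π, ρ_T π)` is `ℚ`-free. -/
theorem linearIndependent_pi_rhoT : LinearIndependent ℚ ![Real.pi, rhoT * Real.pi] :=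
  linearIndependent_pi_smul_pi rhoT_liouville_pos_irrational.2.2

/-- The named cell in the verbatim shape of X's body (`m = 2`, `r = (π, ρ_T π)`). -/
theorem kleinPolarSchanuel_body_two_pi_rhoT (hN : LogSizeMeasure 4 24 nesterenkoTriple) :
    ((2 + 2 : ℕ) : Cardinal) ≤ Algebra.trdeg ℚ ↥(IntermediateField.adjoin ℚ
      (Set.range (Fin.append (fun j => ((![Real.pi, rhoT * Real.pi] j : ℝ) : ℂ))
          (fun j => ((![Real.pi, rhoT * Real.pi] j : ℝ) : ℂ) * Complex.I)) ∪
        Set.range (Complex.exp ∘ Fin.append (fun j => ((![Real.pi, rhoT * Real.pi] j : ℝ) : ℂ))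
          (fun j => ((![Real.pi, rhoT * Real.pi] j : ℝ) : ℂ) * Complex.I)))) :=
  four_le_polarDeg_pi_rhoT hN

/-- SHAPE CHECK (costume direction): X ⟹ the named cell, by instantiation (`m = 2`, `r = (π, ρ_T π)`). -/
theorem kleinPolarSchanuel_instance_pi_rhoT
    (hX : Summit.Schanuel.Schanuel.Theses.RootDecomp1B.KleinPolarSchanuel) :
    ((2 + 2 : ℕ) : Cardinal) ≤ polarDeg ![Real.pi, rhoT * Real.pi] :=
  hX 2 ![Real.pi, rhoT * Real.pi] linearIndependent_pi_rhoT

/-- **SEPARATION from EVERY earlier storey-two cell over `π`** (g33: `(π, ρπ)` with `ρ` ultra-Liouville; B-R21 (d):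
`ρ` hyper-Liouville): the set `{π, ρ_T π}` is `{π, uπ}` for NO hyper-Liouville `u`. -/
theorem range_pi_rhoT_ne_hyper_cell :
    ¬ ∃ u : ℝ, HyperLiouville u ∧ Set.range ![Real.pi, rhoT * Real.pi] = Set.range ![Real.pi, u * Real.pi] := by
  rintro ⟨u, hu, hset⟩
  have hmem : rhoT * Real.pi ∈ Set.range ![Real.pi, u * Real.pi] := hset ▸ ⟨1, rfl⟩
  obtain ⟨i, hi⟩ := hmem
  fin_cases i
  · have h1 : Real.pi = rhoT * Real.pi := by simpa using hi
    have h2 : rhoT = 1 := by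
      have : rhoT * Real.pi = 1 * Real.pi := by rw [one_mul]; exact h1.symm
      exact mul_right_cancel₀ Real.pi_ne_zero this
    exact rhoT_liouville_pos_irrational.2.2 ⟨1, by rw [h2]; norm_num⟩
  · have h2 : u * Real.pi = rhoT * Real.pi := by simpa using hi
    have h3 : u = rhoT := mul_right_cancel₀ Real.pi_ne_zero h2
    exact not_hyperLiouville_rhoT (h3 ▸ hu)

/-- … nor `{1, u}` with `u` hyper-Liouville (the g30/g31 cells over `1`): `π ≠ 1` and `π` is not Liouville. -/
theorem range_pi_rhoT_ne_storey_one :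
    ¬ ∃ u : ℝ, HyperLiouville u ∧ Set.range ![Real.pi, rhoT * Real.pi] = Set.range ![(1 : ℝ), u] := by
  rintro ⟨u, hu, hset⟩
  have hπ : Real.pi ∈ Set.range ![(1 : ℝ), u] := hset ▸ ⟨0, rfl⟩
  obtain ⟨i, hi⟩ := hπ
  fin_cases i
  · have h1 : (1 : ℝ) = Real.pi := by simpa using hi
    linarith [Real.pi_gt_three]
  · have h2 : u = Real.pi := by simpa using hi
    exact not_liouville_pi (h2 ▸ hu.liouville)

/-- … nor `{π, uπ}` with `u` ULTRA-Liouville (g33's cells, tree `RootDecomp1BNesterenkoRadical03`). -/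
theorem range_pi_rhoT_ne_ultra_cell :
    ¬ ∃ u : ℝ, UltraLiouville u ∧ Set.range ![Real.pi, rhoT * Real.pi] = Set.range ![Real.pi, u * Real.pi] :=
  fun ⟨u, hu, h⟩ => range_pi_rhoT_ne_hyper_cell ⟨u, hu.hyperLiouville, h⟩

/-- Not on an E-line `ρ′ · (γ₁, γ₂)` with an algebraic frame (g32 / lens-2 cells), for any LIOUVILLE `ρ` (tree part 03
has this for ultra-Liouville `ρ`; the proof only uses transcendence of `ρ`). -/
theorem pi_smul_pi_ne_algebraic_line_of_liouville {ρ : ℝ} (hρ : Liouville ρ) :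
    ¬ ∃ (ρ' γ₁ γ₂ : ℝ), IsAlgebraic ℚ ((γ₁ : ℝ) : ℂ) ∧ IsAlgebraic ℚ ((γ₂ : ℝ) : ℂ) ∧ γ₁ ≠ 0 ∧
      ![Real.pi, ρ * Real.pi] = ![ρ' * γ₁, ρ' * γ₂] := by
  rintro ⟨ρ', γ₁, γ₂, h₁, h₂, hγ, heq⟩
  have e0 : Real.pi = ρ' * γ₁ := by simpa using congr_fun heq 0
  have e1 : ρ * Real.pi = ρ' * γ₂ := by simpa using congr_fun heq 1
  have hρ'0 : ρ' ≠ 0 := by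
    rintro rfl
    exact Real.pi_ne_zero (by rw [zero_mul] at e0; exact e0)
  have hρeq : ρ = γ₂ / γ₁ := by
    field_simp
    have : ρ * (ρ' * γ₁) = ρ' * γ₂ := by rw [← e0]; exact e1
    have h' : ρ' * (ρ * γ₁) = ρ' * γ₂ := by linear_combination this
    exact mul_left_cancel₀ hρ'0 h'
  have halg : IsAlgebraic ℚ ((ρ : ℝ) : ℂ) := by
    rw [hρeq, Complex.ofReal_div]
    exact h₂.mul h₁.inv
  exact Summit.Schanuel.Schanuel.Theorems.RootDecomp1KHyper.transcendental_ofReal_of_liouville hρ halg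

/-- The member `(π, ρ_T π)` is on no algebraic E-line. -/
theorem pi_rhoT_ne_algebraic_line :
    ¬ ∃ (ρ' γ₁ γ₂ : ℝ), IsAlgebraic ℚ ((γ₁ : ℝ) : ℂ) ∧ IsAlgebraic ℚ ((γ₂ : ℝ) : ℂ) ∧ γ₁ ≠ 0 ∧
      ![Real.pi, rhoT * Real.pi] = ![ρ' * γ₁, ρ' * γ₂] :=
  pi_smul_pi_ne_algebraic_line_of_liouville rhoT_liouville_pos_irrational.1

/-! ### The HYPER-Liouville named member `λ_H` (tree `RootDecomp1KHyper.HyperCell.lambdaH`, `hyperLiouville_lambdaH`):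
the cell of critic rule B-R21 (d) at a NAMED point, and its separation from `ρ_T` -/

/-- **`t(π, λ_H π) ≥ 4`** (`λ_H` hyper-Liouville, tree). -/
theorem four_le_polarDeg_pi_lambdaH (hN : LogSizeMeasure 4 24 nesterenkoTriple) :
    ((2 + 2 : ℕ) : Cardinal) ≤ polarDeg ![Real.pi, lambdaH * Real.pi] :=
  four_le_polarDeg_pi_hyper hN hyperLiouville_lambdaH

/-- `(π, λ_H π)` is ℚ-free (hypothesis-free). -/
theorem linearIndependent_pi_lambdaH : LinearIndependent ℚ ![Real.pi, lambdaH * Real.pi] :=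
  linearIndependent_pi_smul_pi hyperLiouville_lambdaH.irrational

/-- SHAPE CHECK: X ⟹ the `λ_H` cell by instantiation. -/
theorem kleinPolarSchanuel_instance_pi_lambdaH
    (hX : Summit.Schanuel.Schanuel.Theses.RootDecomp1B.KleinPolarSchanuel) :
    ((2 + 2 : ℕ) : Cardinal) ≤ polarDeg ![Real.pi, lambdaH * Real.pi] :=
  hX 2 ![Real.pi, lambdaH * Real.pi] linearIndependent_pi_lambdaH

/-- The two named members are different numbers (one is hyper-Liouville, the other is not). -/
theorem rhoT_ne_lambdaH : rhoT ≠ lambdaH := fun h => not_hyperLiouville_rhoT (h ▸ hyperLiouville_lambdaH)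

/-- **FLAGSHIP (mod the §A measure `hN`, i.e. mod the three named tree-proved facts).** There is a real `ρ > 0`, of finite Liouville order and NOT hyper-Liouville, with
`(π, ρπ)` ℚ-free, TAME, over the SHARP hyperplane `(π)`, and `t(π, ρπ) ≥ 4`: X(2) decided at a storey-two cell OUTSIDE
every ultra- or hyper-Liouville cell. -/
theorem exists_storey_two_cell_pi_finiteOrder (hN : LogSizeMeasure 4 24 nesterenkoTriple) :
    ∃ ρ : ℝ, 0 < ρ ∧ Irrational ρ ∧ ¬ HyperLiouville ρ ∧ LinearIndependent ℚ ![Real.pi, ρ * Real.pi] ∧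
      IsTame 2 ![Real.pi, ρ * Real.pi] ∧ HasSharpHyperplane 1 ![Real.pi, ρ * Real.pi] ∧
      ((2 + 2 : ℕ) : Cardinal) ≤ polarDeg ![Real.pi, ρ * Real.pi] :=
  ⟨rhoT, rhoT_liouville_pos_irrational.2.1, rhoT_liouville_pos_irrational.2.2, not_hyperLiouville_rhoT,
    linearIndependent_pi_rhoT, isTame_pi_smul_pi rhoT, hasSharpHyperplane_pi_smul_pi rhoT, four_le_polarDeg_pi_rhoT hN⟩

/-! ### The same cells with the §A input DISCHARGED down to the three registered facts BY NAME
(`h11 : nesterenko1996_thm_1_1`, `h51 : NesterenkoPhilippon2001_ch3_thm_5_1`, `h411 : NesterenkoPhilippon2001_ch3_prop_4_11`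
— all three PROVED in the tree: `nesterenko1996_thm_1_1_holds`, `NesterenkoPhilippon2001_ch3_thm_5_1_holds`,
`NesterenkoPhilippon2001_ch3_prop_4_11_holds`; plugging those in makes every cell below hypothesis-free) -/

/-- X(2)(π, ρπ), `ρ` of order 57, mod the three named facts. -/
theorem four_le_polarDeg_pi_of_facts (h11 : nesterenko1996_thm_1_1) (h51 : NesterenkoPhilippon2001_ch3_thm_5_1)
    (h411 : NesterenkoPhilippon2001_ch3_prop_4_11) {ρ : ℝ} (hρ : LiouvilleOrder 57 ρ) :
    ((2 + 2 : ℕ) : Cardinal) ≤ polarDeg ![Real.pi, ρ * Real.pi] :=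
  four_le_polarDeg_pi (logSizeMeasure_nesterenkoTriple_of h11 h51 h411) hρ

/-- X(2)(π, ρπ), `ρ` hyper-Liouville (critic rule B-R21 (d)), mod the three named facts. -/
theorem four_le_polarDeg_pi_hyper_of_facts (h11 : nesterenko1996_thm_1_1)
    (h51 : NesterenkoPhilippon2001_ch3_thm_5_1) (h411 : NesterenkoPhilippon2001_ch3_prop_4_11) {ρ : ℝ}
    (hρ : HyperLiouville ρ) : ((2 + 2 : ℕ) : Cardinal) ≤ polarDeg ![Real.pi, ρ * Real.pi] :=
  four_le_polarDeg_pi_hyper (logSizeMeasure_nesterenkoTriple_of h11 h51 h411) hρ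

/-- T0At (ρπ | π), mod the three named facts. -/
theorem tameDefectZeroAt_smul_pi_pi_of_facts (h11 : nesterenko1996_thm_1_1)
    (h51 : NesterenkoPhilippon2001_ch3_thm_5_1) (h411 : NesterenkoPhilippon2001_ch3_prop_4_11) {ρ : ℝ}
    (hρ : LiouvilleOrder 57 ρ) : TameDefectZeroAt 1 ![ρ * Real.pi, Real.pi] :=
  tameDefectZeroAt_smul_pi_pi (logSizeMeasure_nesterenkoTriple_of h11 h51 h411) hρ

/-- The named cell `t(π, ρ_T π) ≥ 4` in X's verbatim body shape, mod the three named facts. -/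
theorem kleinPolarSchanuel_body_two_pi_rhoT_of_facts (h11 : nesterenko1996_thm_1_1)
    (h51 : NesterenkoPhilippon2001_ch3_thm_5_1) (h411 : NesterenkoPhilippon2001_ch3_prop_4_11) :
    ((2 + 2 : ℕ) : Cardinal) ≤ Algebra.trdeg ℚ ↥(IntermediateField.adjoin ℚ
      (Set.range (Fin.append (fun j => ((![Real.pi, rhoT * Real.pi] j : ℝ) : ℂ))
          (fun j => ((![Real.pi, rhoT * Real.pi] j : ℝ) : ℂ) * Complex.I)) ∪
        Set.range (Complex.exp ∘ Fin.append (fun j => ((![Real.pi, rhoT * Real.pi] j : ℝ) : ℂ))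
          (fun j => ((![Real.pi, rhoT * Real.pi] j : ℝ) : ℂ) * Complex.I)))) :=
  kleinPolarSchanuel_body_two_pi_rhoT (logSizeMeasure_nesterenkoTriple_of h11 h51 h411)

/-- FLAGSHIP, mod the three named facts. -/
theorem exists_storey_two_cell_pi_finiteOrder_of_facts (h11 : nesterenko1996_thm_1_1)
    (h51 : NesterenkoPhilippon2001_ch3_thm_5_1) (h411 : NesterenkoPhilippon2001_ch3_prop_4_11) :
    ∃ ρ : ℝ, 0 < ρ ∧ Irrational ρ ∧ ¬ HyperLiouville ρ ∧ LinearIndependent ℚ ![Real.pi, ρ * Real.pi] ∧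
      IsTame 2 ![Real.pi, ρ * Real.pi] ∧ HasSharpHyperplane 1 ![Real.pi, ρ * Real.pi] ∧
      ((2 + 2 : ℕ) : Cardinal) ≤ polarDeg ![Real.pi, ρ * Real.pi] :=
  exists_storey_two_cell_pi_finiteOrder (logSizeMeasure_nesterenkoTriple_of h11 h51 h411)

end Cells

end Summit.Schanuel.Schanuel.Theorems.RootDecomp1BFiniteOrderRadical

end
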